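import Summits.RiemannHypothesis.RiemannHypothesis.Theses.NbGhostOfThePole
import Summits.RiemannHypothesis.RiemannHypothesis.Theorems.Splittings.NbTruncationA
import Summits.RiemannHypothesis.RiemannHypothesis.Theorems.Splittings.NbSharpFloorKernel
import HarnessLib

/-!
# Route NbGhostOfThePole — support item `SharpZeroFloor` (stmt-RiemannHypothesis-22977)

The SHARP reproducing-kernel floor for the SECTIONS `ζ_M(s) = Σ_{n ≤ M} n^{-s}` inside the
Báez-Duarte distance (same integrand, weight `dt/(1/4+t²)`, line `Re s = 1/2` and mollifier class
`A_a(s) = Σ_{k<N} a_k (k+1)^{-s}` as the routes `NymanBeurling` / `NbTruncationBarrier` /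
`NbGhostOfThePole`):

  if `ζ_M(ρ) = 0` with `Re ρ > 1/2`, then for EVERY `N`, `a`,
  `2π (2 Re ρ - 1) / ‖ρ‖² ≤ ∫ |1 - ζ_M(1/2+it) A_a(1/2+it)|² dt/(1/4+t²)`.

This is the port of the tree's Nikolski floor `Splittings.NbSharpFloor.nbIntegrand_sharpFloor_of_zero`
from `ζ` to `ζ_M`: there is NO pole, hence no Blaschke factor `(s-1)/(s+1)` and no regularisation
`R²/(s+R)²` — the test function is simply `F(s) = (1 - ζ_M(s) A(s))/s`, holomorphic on `Re s > 0`
with `‖F(s)‖ ≤ (1 + M Σ‖a_k‖)/‖s‖` on `Re s ≥ 1/2` and `F(ρ) = 1/ρ` whatever `A` is.  The contour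
inequality `Literature.NumberTheory.LFunctions.ofReal_norm_le_lintegral_line` gives
`2π/‖ρ‖ ≤ ∫ ‖F(1/2+it)‖/‖1/2+it-ρ‖ dt`, and Cauchy–Schwarz against the EXACT Poisson mass
`∫ dt/‖1/2+it-ρ‖² = π/(Re ρ - 1/2)` (`Splittings.NbSharpFloor.integral_inv_sq_add_sq_le`) yields
`4π²/‖ρ‖² ≤ I · π/(Re ρ - 1/2)`, i.e. the floor `4π(Re ρ - 1/2)/‖ρ‖² = 2π(2Re ρ - 1)/‖ρ‖²`.  It
improves the lane-(xv-V) floor `Splittings.NbTruncation.truncIntegrand_floor_of_zero`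
(`4π(Re ρ-1/2)²/(‖ρ‖²‖ρ+1‖²)`) by the factor `‖ρ+1‖²/(Re ρ - 1/2)`, and it is TIGHT: at `M = 0`
(`ζ_0 = 0`), `ρ = 1` both sides equal `2π`.

Contents: §1 the pole-free test function (holomorphy, growth, critical-line factorisation); §2 the
exact Poisson mass of the bare Cauchy kernel; §3 the floor `sectionIntegrand_sharpFloor_of_zero` and
the closer `SharpZeroFloor_proof : …Theses.NbGhostOfThePole.SharpZeroFloor` (by name).

RH-free, unconditional, no definitions, standard axioms.  References: A. Beurling, Proc. Nat. Acad.
Sci. 41 (1955) 312–314 (easy half); N. Nikolski, Ann. Inst. Fourier 45 (1995) 143–159, Thm 0.1;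
J.-F. Burnol, Adv. Math. 170 (2002) (lower bounds by point evaluation at zeros).
No summit is proved by this file; nothing here bears on the truth of RH.
-/

noncomputable section

-- D-0017: `Summit.<S>.<S>.…` is the designed namespace of a single-problem summit.
set_option linter.dupNamespace false

open Complex MeasureTheory Set Filter
open scoped Real ENNReal

namespace Summit.RiemannHypothesis.RiemannHypothesis.Theorems.NbGhostOfThePole

open Literature.NumberTheory.LFunctions
open Literature.Barriers.RiemannHypothesis
open Summit.RiemannHypothesis.RiemannHypothesis.Theorems.Splittings

/-! ## §1 — The pole-free test function `F(s) = (1 - ζ_M(s) A_a(s))/s` -/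

/-- `F(s) = (1 - ζ_M(s)A_a(s))/s` is holomorphic on `Re s > 0`. [folklore] -/
theorem differentiableOn_sectionAux (M : ℕ) {N : ℕ} (a : Fin N → ℂ) :
    DifferentiableOn ℂ (fun s ↦ (1 - zetaPartialSum M s * dirichletPoly a s) / s)
      {s : ℂ | 0 < s.re} := by
  have h1 : Differentiable ℂ fun s ↦ 1 - zetaPartialSum M s * dirichletPoly a s :=
    (differentiable_const 1).sub
      ((differentiable_zetaPartialSum M).mul (differentiable_dirichletPoly a))
  refine DifferentiableOn.div h1.differentiableOn differentiableOn_id ?_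
  intro s hs h
  have hs' : 0 < s.re := hs
  rw [h] at hs'
  simp at hs'

/-- Growth: `‖F(s)‖ ≤ (1 + M Σ‖a_k‖)/‖s‖` for `Re s ≥ 1/2` (`‖ζ_M‖ ≤ M`, `‖A_a‖ ≤ Σ‖a_k‖` on the
closed right half-plane). [folklore] -/
theorem norm_sectionAux_le (M : ℕ) {N : ℕ} (a : Fin N → ℂ) {s : ℂ} (hs : 1 / 2 ≤ s.re) :
    ‖(1 - zetaPartialSum M s * dirichletPoly a s) / s‖ ≤
      (1 + M * ∑ n : Fin N, ‖a n‖) / ‖s‖ := by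
  have hs0 : 0 ≤ s.re := by linarith
  have hnum : ‖1 - zetaPartialSum M s * dirichletPoly a s‖ ≤ 1 + M * ∑ n : Fin N, ‖a n‖ := by
    calc ‖1 - zetaPartialSum M s * dirichletPoly a s‖
        ≤ ‖(1 : ℂ)‖ + ‖zetaPartialSum M s * dirichletPoly a s‖ := norm_sub_le _ _
      _ = 1 + ‖zetaPartialSum M s‖ * ‖dirichletPoly a s‖ := by rw [norm_one, norm_mul]
      _ ≤ 1 + M * ∑ n : Fin N, ‖a n‖ := by
          gcongr
          · exact NbTruncation.norm_zetaPartialSum_le_self M hs0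
          · exact norm_dirichletPoly_le a hs0
  rw [norm_div]
  gcongr

/-- On the critical line, `‖F(s)/(s-ρ)‖ₑ = (‖1 - ζ_M(s)A_a(s)‖/‖s‖) · ‖(s-ρ)⁻¹‖ₑ`. [folklore] -/
theorem enorm_sectionAux_div_line (M : ℕ) (ρ : ℂ) {N : ℕ} (a : Fin N → ℂ) (t : ℝ) :
    ‖(1 - zetaPartialSum M (1 / 2 + t * I) * dirichletPoly a (1 / 2 + t * I)) /
          (1 / 2 + t * I) / (1 / 2 + t * I - ρ)‖ₑ =
      ENNReal.ofReal (‖1 - zetaPartialSum M (1 / 2 + t * I) * dirichletPoly a (1 / 2 + t * I)‖ /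
          ‖(1 / 2 : ℂ) + t * I‖) * ‖((1 / 2 : ℂ) + t * I - ρ)⁻¹‖ₑ := by
  rw [div_eq_mul_inv _ ((1 / 2 : ℂ) + t * I - ρ), enorm_mul, ← ofReal_norm, norm_div]

/-! ## §2 — The exact Poisson mass of the bare Cauchy kernel on the critical line -/

/-- `∫_ℝ ‖(1/2+it-ρ)⁻¹‖² dt ≤ π/(Re ρ - 1/2)` for `Re ρ > 1/2` (in fact equality: the Poisson mass
`∫ dt/(δ²+(t-γ)²) = π/δ`, `δ = Re ρ - 1/2`, `γ = Im ρ`). [folklore] -/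
theorem lintegral_inv_line_sub_sq_le {ρ : ℂ} (hρ : 1 / 2 < ρ.re) :
    ∫⁻ t : ℝ, ‖((1 / 2 : ℂ) + t * I - ρ)⁻¹‖ₑ ^ (2 : ℝ) ≤ ENNReal.ofReal (π / (ρ.re - 1 / 2)) := by
  set δ := ρ.re - 1 / 2 with hδ
  have hδ0 : 0 < δ := by rw [hδ]; linarith
  have hpt : ∀ t : ℝ, ‖((1 / 2 : ℂ) + t * I - ρ)⁻¹‖ ^ 2 = (δ ^ 2 + (t - ρ.im) ^ 2)⁻¹ := by
    intro t
    rw [norm_inv, inv_pow, NbSharpFloor.norm_sq_line_sub, hδ]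
  obtain ⟨hint, hle⟩ := NbSharpFloor.integral_inv_sq_add_sq_le hδ0 ρ.im
  calc ∫⁻ t : ℝ, ‖((1 / 2 : ℂ) + t * I - ρ)⁻¹‖ₑ ^ (2 : ℝ)
      = ∫⁻ t : ℝ, ENNReal.ofReal ((δ ^ 2 + (t - ρ.im) ^ 2)⁻¹) := by
        refine lintegral_congr fun t ↦ ?_
        rw [ENNReal.rpow_two, ← ofReal_norm, ← ENNReal.ofReal_pow (norm_nonneg _), hpt t]
    _ = ENNReal.ofReal (∫ t : ℝ, (δ ^ 2 + (t - ρ.im) ^ 2)⁻¹) := by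
        rw [ofReal_integral_eq_lintegral_ofReal hint]
        exact Eventually.of_forall fun t ↦ by positivity
    _ ≤ ENNReal.ofReal (π / (ρ.re - 1 / 2)) := ENNReal.ofReal_le_ofReal hle

/-! ## §3 — The sharp section floor -/

/-- **Sharp zero floor for the sections.** If `ζ_M(ρ) = 0` with `Re ρ > 1/2`, then for EVERY
Dirichlet polynomial `A(s) = Σ_{k<N} a_k (k+1)^{-s}`,
`2π (2 Re ρ - 1) / ‖ρ‖² ≤ ∫_ℝ |1 - ζ_M(1/2+it) A(1/2+it)|² dt/(1/4+t²)`.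
Proof: the contour inequality for `F(s) = (1 - ζ_M A)/s` (`F(ρ) = 1/ρ`) gives
`2π/‖ρ‖ ≤ ∫ ‖F‖/‖s-ρ‖ ≤ I^{1/2} (π/(Re ρ-1/2))^{1/2}` (Cauchy–Schwarz,
`lintegral_inv_line_sub_sq_le`); square and divide.  Tight at `M = 0`, `ρ = 1`.
[cite: Beurling1955, Theorem (easy half)] [cite: Nikolski1995, Thm 0.1] -/
theorem sectionIntegrand_sharpFloor_of_zero {M : ℕ} {ρ : ℂ} (hζ : zetaPartialSum M ρ = 0)
    (hρ : 1 / 2 < ρ.re) (N : ℕ) (a : Fin N → ℂ) :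
    ENNReal.ofReal (2 * π * (2 * ρ.re - 1) / ‖ρ‖ ^ 2) ≤
      ∫⁻ t : ℝ, ENNReal.ofReal (‖1 - zetaPartialSum M (1 / 2 + t * Complex.I) *
        ∑ n : Fin N, a n * ((n : ℂ) + 1) ^ (-(1 / 2 + t * Complex.I))‖ ^ 2 / (1 / 4 + t ^ 2)) := by
  have hρ0 : ρ ≠ 0 := by
    intro h; rw [h] at hρ; simp at hρ; linarith
  have hδ0 : 0 < ρ.re - 1 / 2 := by linarith
  have hn0 : 0 < ‖ρ‖ := norm_pos_iff.mpr hρ0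
  -- the two constants
  set v : ℝ := 2 * π * ‖(1 : ℂ) / ρ‖ with hv
  have hv' : v = 2 * π / ‖ρ‖ := by
    rw [hv, norm_div, norm_one]; ring
  have hv0 : 0 < v := by rw [hv']; positivity
  set K : ℝ := π / (ρ.re - 1 / 2) with hK
  have hK0 : 0 < K := div_pos Real.pi_pos hδ0
  have hc : 2 * π * (2 * ρ.re - 1) / ‖ρ‖ ^ 2 = v ^ 2 / K := by
    rw [hv', hK]
    field_simp
  -- the integral and the kernel mass
  set Iv : ℝ≥0∞ := ∫⁻ t : ℝ, ENNReal.ofReal (‖1 - zetaPartialSum M (1 / 2 + t * Complex.I) *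
      ∑ n : Fin N, a n * ((n : ℂ) + 1) ^ (-(1 / 2 + t * Complex.I))‖ ^ 2 / (1 / 4 + t ^ 2)) with hIv
  set G : ℝ≥0∞ := ∫⁻ t : ℝ, ‖((1 / 2 : ℂ) + t * I - ρ)⁻¹‖ₑ ^ (2 : ℝ) with hG
  have hGle : G ≤ ENNReal.ofReal K := lintegral_inv_line_sub_sq_le hρ
  have hg_meas : Measurable fun t : ℝ ↦ ‖((1 / 2 : ℂ) + t * I - ρ)⁻¹‖ₑ := by
    refine Measurable.enorm ?_
    exact (by fun_prop : Measurable fun t : ℝ ↦ ((1 / 2 : ℂ) + t * I - ρ)⁻¹)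
  -- Step 1: the contour inequality and Cauchy–Schwarz: `ofReal v ≤ Iv^{1/2} G^{1/2}`
  have key : ENNReal.ofReal v ≤ Iv ^ (1 / 2 : ℝ) * G ^ (1 / 2 : ℝ) := by
    set A := ∑ n : Fin N, ‖a n‖ with hA
    have hA0 : 0 ≤ A := Finset.sum_nonneg fun n _ ↦ norm_nonneg _
    have hC : 0 ≤ 1 + M * A := by positivity
    have hcore := ofReal_norm_le_lintegral_line
      (F := fun s ↦ (1 - zetaPartialSum M s * dirichletPoly a s) / s)
      hρ (differentiableOn_sectionAux M a) (R₀ := 1) hC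
      (fun s hs _ ↦ norm_sectionAux_le M a hs)
    have hval : (1 - zetaPartialSum M ρ * dirichletPoly a ρ) / ρ = 1 / ρ := by
      rw [hζ, zero_mul, sub_zero]
    simp only [hval] at hcore
    refine hcore.trans ?_
    set f : ℝ → ℝ≥0∞ := fun t ↦ ENNReal.ofReal
      (‖1 - zetaPartialSum M (1 / 2 + t * I) * dirichletPoly a (1 / 2 + t * I)‖ /
        ‖(1 / 2 : ℂ) + t * I‖) with hf
    set g : ℝ → ℝ≥0∞ := fun t ↦ ‖((1 / 2 : ℂ) + t * I - ρ)⁻¹‖ₑ with hg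
    have hf_meas : Measurable f := by
      refine ENNReal.measurable_ofReal.comp ?_
      refine Measurable.div ?_ (by fun_prop)
      refine (Continuous.norm ?_).measurable
      have hc : Continuous fun t : ℝ ↦ (1 / 2 : ℂ) + t * I := by fun_prop
      exact continuous_const.sub
        (((differentiable_zetaPartialSum M).continuous.comp hc).mul
          ((NymanBeurlingDirichlet.continuous_dirichletPoly a).comp hc))
    calc ∫⁻ t : ℝ, ‖(1 - zetaPartialSum M (1 / 2 + t * I) * dirichletPoly a (1 / 2 + t * I)) /
            (1 / 2 + t * I) / (1 / 2 + t * I - ρ)‖ₑ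
        = ∫⁻ t : ℝ, (f * g) t := lintegral_congr fun t ↦ enorm_sectionAux_div_line M ρ a t
      _ ≤ (∫⁻ t, f t ^ (2 : ℝ)) ^ (1 / (2 : ℝ)) * (∫⁻ t, g t ^ (2 : ℝ)) ^ (1 / (2 : ℝ)) :=
          ENNReal.lintegral_mul_le_Lp_mul_Lq volume Real.HolderConjugate.two_two
            hf_meas.aemeasurable hg_meas.aemeasurable
      _ = Iv ^ (1 / 2 : ℝ) * G ^ (1 / 2 : ℝ) := by
          congr 2
          refine lintegral_congr fun t ↦ ?_
          rw [hf]
          dsimp only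
          rw [ENNReal.rpow_two, ← ENNReal.ofReal_pow (by positivity), div_pow,
            norm_sq_one_half_add t]
          rfl
  -- Step 2: replace `G` by its bound and pass to real numbers
  have key2 : ENNReal.ofReal v ≤ Iv ^ (1 / 2 : ℝ) * ENNReal.ofReal (Real.sqrt K) := by
    have hGK : G ^ (1 / 2 : ℝ) ≤ ENNReal.ofReal (Real.sqrt K) :=
      calc G ^ (1 / 2 : ℝ) ≤ (ENNReal.ofReal K) ^ (1 / 2 : ℝ) :=
            ENNReal.rpow_le_rpow hGle (by norm_num)
        _ = ENNReal.ofReal (Real.sqrt K) := by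
            rw [ENNReal.ofReal_rpow_of_nonneg hK0.le (by norm_num), Real.sqrt_eq_rpow]
    calc ENNReal.ofReal v ≤ Iv ^ (1 / 2 : ℝ) * G ^ (1 / 2 : ℝ) := key
      _ ≤ Iv ^ (1 / 2 : ℝ) * ENNReal.ofReal (Real.sqrt K) := by gcongr
  rcases eq_or_ne Iv ⊤ with htop | hfin
  · rw [htop]; exact le_top
  set i : ℝ := Iv.toReal with hi
  have hi0 : 0 ≤ i := ENNReal.toReal_nonneg
  have hIi : Iv = ENNReal.ofReal i := (ENNReal.ofReal_toReal hfin).symm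
  have hreal : v ≤ Real.sqrt i * Real.sqrt K := by
    have h := key2
    rw [hIi, ENNReal.ofReal_rpow_of_nonneg hi0 (by norm_num), ← Real.sqrt_eq_rpow,
      ← ENNReal.ofReal_mul (Real.sqrt_nonneg _)] at h
    exact (ENNReal.ofReal_le_ofReal_iff (by positivity)).mp h
  have hsq : v ^ 2 ≤ i * K := by
    have h := pow_le_pow_left₀ hv0.le hreal 2
    have e : (Real.sqrt i * Real.sqrt K) ^ 2 = i * K := by
      rw [mul_pow, Real.sq_sqrt hi0, Real.sq_sqrt hK0.le]
    exact h.trans_eq e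
  rw [hc, hIi]
  refine ENNReal.ofReal_le_ofReal ?_
  rwa [div_le_iff₀ hK0]

/-- **Closer of item stmt-RiemannHypothesis-22977** (route `NbGhostOfThePole`, support r9), by name:
the sharp section floor `2π(2Re ρ − 1)/‖ρ‖² ≤ ∫ |1 − ζ_M A_a|² dt/(1/4+t²)` at every zero `ρ` of
`ζ_M` with `Re ρ > 1/2`, for all `N`, `a` (`sectionIntegrand_sharpFloor_of_zero`).  RH-free; no
summit is proved by this; nothing here bears on the truth of RH.
[cite: Nikolski1995, Thm 0.1] [cite: Burnol2002, Thm 1.3 (point evaluation at zeros)] -/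
theorem SharpZeroFloor_proof :
    Summit.RiemannHypothesis.RiemannHypothesis.Theses.NbGhostOfThePole.SharpZeroFloor := by
  intro M ρ hζ hρ N a
  exact sectionIntegrand_sharpFloor_of_zero hζ hρ N a

end Summit.RiemannHypothesis.RiemannHypothesis.Theorems.NbGhostOfThePole

end
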